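import Summits.RiemannHypothesis.RiemannHypothesis.Theorems.MotivicDoorCertPosGram
import Summits.RiemannHypothesis.RiemannHypothesis.Theorems.PfPersistencePolarRankOne
import Summits.RiemannHypothesis.RiemannHypothesis.Theorems.PfPersistenceWeilParityPair
import HarnessLib

/-!
# Motivic door / CERTPOS — conditioned classes (`rhdoor.certpos/2`): penalty lower bounds and exact class witnesses

pub-rhdoor (MOTIVIC-DOOR ticket), unit `certpos` (gen 2). HONEST FRAMING: lottery ticket at the motivic door; RH probability
negligible; consolation prizes are real (a semi-local Weil-positivity theorem, or a located gap in the Connes–Consani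
programme, plus the ff-door theorem). THIS FILE is instrumentation only — finite linear algebra, RH-free, `ζ`-free.

The CONDITIONS LADDER (Connes–Consani 2021, Theorem 1: `W_∞(g ⋆ g̃) ≥ 0` for `supp g ⊆ [−(log 2)/2, (log 2)/2]` with the
pole condition `ĝ(i/2) = 0` and the centre condition `ĝ(0) = 0`; tree: `Literature.NumberTheory.ConnesConsani2021`)
restricts the N-truncated Weil form (tree: `PfPersistence.evenBlock` / `oddBlock`) to a CONDITIONED CLASS inside the
trigonometric test space `V_N`: a linear constraint `d ⬝ᵥ v = 0` with an explicit real vector `d` (for the even sector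
`d_n = polarGen (2a) n`, the generator of the polar block, `polarBlock_eq_smul_vecMulVec`; for the odd sector
`d_p = oddPolarGen (2a) p = 2k_p/(1/4 + k_p²)`, `k_p = 2πp/(2a)`), and the centre condition `v 0 = 0` (drop mode 0).
DICTIONARY (cutoff profiles `g = Σ v_n ξ_n + Σ u_p η_p ∈ V_N`, `ξ`/`η` = `xiEven`/`xiOdd`):
`∫ g e^{∓x/2} dx = √(ρ(2a)/2)·(polarGen ⬝ᵥ v ± oddPolarGen ⬝ᵥ u)`, `∫ g = √(2a)·v 0`, `ρ = polarScale` — so CC's two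
conditions on even `g` read `v 0 = 0 ∧ polarGen ⬝ᵥ v = 0`, on odd `g` just `oddPolarGen ⬝ᵥ u = 0` [DERIVED, elementary
calculus; the `W02`-side of it is PROVED in the tree for the even sector as `W02_thetaEven`].

Two kernel-checked devices over a `GramCert` (`MotivicDoorCertPosGram`, schema `/1` data = integer balls for a matrix `P`):

* LOWER, by PENALTY (`form_ge_margin_of_orth`): if the certificate encloses `P = A + s • d dᵀ` and is `Valid`, then
  `margin · vᵀv ≤ vᵀAv` for every `v` with `d ⬝ᵥ v = 0` — because `vᵀ(s • d dᵀ)v = s (d ⬝ᵥ v)² = 0`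
  (`form_add_smul_vecMulVec`). So `margin > 0` certifies the class bottom on `V_N` positive (a FINITE-N statement).
* NEGATIVE, by an EXACT CLASS WITNESS (`exists_neg_of_classNegOK`): integer data `z : ClassWitness` (scale `2^td`,
  midpoints `D`, radii `rD` of an enclosure of `d` — for `polarGen`/`oddPolarGen` these enclosures are PROVED from
  Mathlib's 20-digit `π` bounds by the checkers `evenEnclOK` / `oddEnclOK` of `MotivicDoorCertPosPolarEncl`, so they are NOT data; an integer
  vector `w`; an index `j`) defines the REAL vector `v = d_j • w − (d ⬝ᵥ w) • e_j`, which satisfies `d ⬝ᵥ v = 0`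
  EXACTLY, and the decidable check `classNegOK` bounds `2^(2td+t) · vᵀPv` above by an integer `numBound < 0` through the
  three-factor perturbation inequality `mul3_le`. Hence `vᵀAv = vᵀPv < 0`: the class bottom on `V_N` is NEGATIVE —
  given the enclosure of `P` (DATA, two interval engines) and nothing else.

Companion files: `MotivicDoorCertPosPolarEncl` (PROVED `π`-enclosures of the constraint vectors), `MotivicDoorCertPosCoupled`
(full-parity classes coupled by one pole condition).
Per-cell files (`MotivicDoorCertPos<tag><Class>.lean`) instantiate `A := evenBlock (datumOf w) win` (minor of modes
`1..N` for the centre condition) or `oddBlock …`, `s := τ · polarScale (2a)`, prove the checks by `decide +kernel`, and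
conclude `Encloses P → (margin · vᵀv ≤ vᵀAv on the class)` or `Encloses P → ∃ v, d ⬝ᵥ v = 0 ∧ vᵀAv < 0`.
What such a cell MEANS for the continuum class (smooth `g`): a negative cell bounds the class crossover `a*_class(S) ≤ a`
only modulo the cutoff → smooth mollification bridge, which is NOT in this file (OWED); a positive cell is finite-N only.
-/

open Finset Matrix Real
open scoped BigOperators

set_option linter.dupNamespace false  -- the mandated namespace repeats `RiemannHypothesis`

namespace Summit.RiemannHypothesis.RiemannHypothesis.Theorems.MotivicDoor.CertPos

open Summit.RiemannHypothesis.RiemannHypothesis.Theorems.PfPersistence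
open Summit.RiemannHypothesis.RiemannHypothesis.Theorems.PfPersistence.PolarRankOne

/-! ## 1. The penalty identity and the conditioned lower bound -/

/-- PROVED: `vᵀ (p qᵀ) v = (p ⬝ᵥ v)(q ⬝ᵥ v)`. [folklore] -/
theorem dotProduct_vecMulVec_mulVec {n : ℕ} (p q v : Fin n → ℝ) :
    v ⬝ᵥ (Matrix.vecMulVec p q *ᵥ v) = (p ⬝ᵥ v) * (q ⬝ᵥ v) := by
  simp only [dotProduct, Matrix.mulVec, Matrix.vecMulVec_apply, Finset.sum_mul_sum]
  apply Finset.sum_congr rfl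
  intro i _
  rw [Finset.mul_sum]
  apply Finset.sum_congr rfl
  intro j _
  ring

/-- PROVED (penalty identity): on the class `d ⬝ᵥ v = 0` the penalised form equals the form. [folklore] -/
theorem form_add_smul_vecMulVec {n : ℕ} (A : Matrix (Fin n) (Fin n) ℝ) (s : ℝ) (d v : Fin n → ℝ)
    (hdv : d ⬝ᵥ v = 0) : v ⬝ᵥ ((A + s • Matrix.vecMulVec d d) *ᵥ v) = v ⬝ᵥ (A *ᵥ v) := by
  rw [Matrix.add_mulVec, dotProduct_add, Matrix.smul_mulVec, dotProduct_smul,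
    dotProduct_vecMulVec_mulVec, hdv]
  simp

/-- **PROVED — CONDITIONED LOWER BOUND.** A valid certificate enclosing the penalised matrix `A + s • d dᵀ` gives
`margin · vᵀv ≤ vᵀAv` for every `v` in the class `d ⬝ᵥ v = 0`. [folklore] -/
theorem form_ge_margin_of_orth (c : GramCert) (hv : c.Valid) {n : ℕ} (hk : c.k = n)
    (A : Matrix (Fin n) (Fin n) ℝ) (s : ℝ) (d : Fin n → ℝ) (hP : c.Encloses (A + s • Matrix.vecMulVec d d))
    (v : Fin n → ℝ) (hdv : d ⬝ᵥ v = 0) : (c.margin : ℝ) * (v ⬝ᵥ v) ≤ v ⬝ᵥ (A *ᵥ v) := by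
  rw [← form_add_smul_vecMulVec A s d v hdv]
  exact form_ge_margin c hv hk _ hP v

/-! ## 2. Exact class witnesses -/

/-- Integer data of a class witness (`rhdoor.certpos/2` fields `constraint.td, Dn, rDn`, `class_witness.w, j`):
an enclosure `|d i − D i / 2^td| ≤ rD i / 2^td` of the constraint vector, an integer vector `w`, an index `j`. [folklore] -/
structure ClassWitness where
  td : ℕ
  D : List ℤ
  rD : List ℕ
  w : List ℤ
  j : ℕ

namespace ClassWitness

variable (z : ClassWitness)

/-- padded accessors [folklore] -/
def Di (i : ℕ) : ℤ := z.D.getD i 0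
/-- [folklore] -/
def rDi (i : ℕ) : ℕ := z.rD.getD i 0
/-- [folklore] -/
def wi (i : ℕ) : ℤ := z.w.getD i 0
/-- `Sn = Σ_i D i · w i` [folklore] -/
def Sn (k : ℕ) : ℤ := ∑ i ∈ Finset.range k, z.Di i * z.wi i
/-- `Rs = Σ_i rD i · |w i|` [folklore] -/
def Rs (k : ℕ) : ℤ := ∑ i ∈ Finset.range k, (z.rDi i : ℤ) * |z.wi i|
/-- integer midpoint of `2^td · v i`: `V i = D j · w i − [i = j] Sn` [folklore] -/
def Vi (k i : ℕ) : ℤ := z.Di z.j * z.wi i - if i = z.j then z.Sn k else 0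
/-- radius of `2^td · v i`: `ρ i = rD j · |w i| + [i = j] Rs` [folklore] -/
def rhoi (k i : ℕ) : ℤ := (z.rDi z.j : ℤ) * |z.wi i| + if i = z.j then z.Rs k else 0

/-- THE CONSTRAINT ENCLOSURE: `|d i − D i / 2^td| ≤ rD i / 2^td` (PROVED from `π` bounds for the polar vectors by the
checkers of §3; DATA otherwise). [folklore] -/
def EnclosesVec {n : ℕ} (d : Fin n → ℝ) : Prop :=
  ∀ i : Fin n, |d i - (z.Di i : ℝ) / 2 ^ z.td| ≤ (z.rDi i : ℝ) / 2 ^ z.td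

end ClassWitness

namespace GramCert

variable (c : GramCert)

/-- one term of the integer upper bound for `2^(2td+t) vᵀPv` [folklore] -/
def numTerm (z : ClassWitness) (i l : ℕ) : ℤ :=
  z.Vi c.k i * z.Vi c.k l * c.Cij i l + |z.Vi c.k i| * |z.Vi c.k l| * (c.rij i l : ℤ) +
    (|z.Vi c.k i| * z.rhoi c.k l + z.rhoi c.k i * |z.Vi c.k l| + z.rhoi c.k i * z.rhoi c.k l) *
      (|c.Cij i l| + (c.rij i l : ℤ))

/-- row sum of `numTerm` [folklore] -/
def numRow (z : ClassWitness) (i : ℕ) : ℤ := ∑ l ∈ Finset.range c.k, c.numTerm z i l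

/-- `numBound = Σ_{i,l} numTerm i l` [folklore] -/
def numBound (z : ClassWitness) : ℤ := ∑ i ∈ Finset.range c.k, c.numRow z i

/-- THE KERNEL CHECK of a class witness: `j < k` and `numBound < 0`. [folklore] -/
def classNegOK (z : ClassWitness) : Bool := decide (z.j < c.k) && decide (c.numBound z < 0)

/-- shardable variant: the row sums are bounded by given integers whose total is negative. [folklore] -/
def numRowsLE (z : ClassWitness) (a n : ℕ) (B : ℤ) : Bool :=
  decide ((∑ i ∈ Finset.range n, c.numRow z (a + i)) ≤ B)

end GramCert

/-- PROVED (three-factor perturbation): `|x−X| ≤ ρx`, `|y−Y| ≤ ρy`, `|z−Z| ≤ r` give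
`xyz ≤ XYZ + |X||Y| r + (|X|ρy + ρx|Y| + ρxρy)(|Z| + r)`. [folklore] -/
theorem mul3_le {x y z X Y Z ρx ρy r : ℝ} (hx : |x - X| ≤ ρx) (hy : |y - Y| ≤ ρy) (hz : |z - Z| ≤ r) :
    x * y * z ≤ X * Y * Z + |X| * |Y| * r + (|X| * ρy + ρx * |Y| + ρx * ρy) * (|Z| + r) := by
  have hρx : 0 ≤ ρx := le_trans (abs_nonneg _) hx
  have hρy : 0 ≤ ρy := le_trans (abs_nonneg _) hy
  have hr : 0 ≤ r := le_trans (abs_nonneg _) hz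
  have h1 : |x * y - X * Y| ≤ |X| * ρy + ρx * |Y| + ρx * ρy := by
    have e : x * y - X * Y = X * (y - Y) + (x - X) * Y + (x - X) * (y - Y) := by ring
    rw [e]
    calc |X * (y - Y) + (x - X) * Y + (x - X) * (y - Y)|
        ≤ |X * (y - Y)| + |(x - X) * Y| + |(x - X) * (y - Y)| := abs_add_three _ _ _
      _ = |X| * |y - Y| + |x - X| * |Y| + |x - X| * |y - Y| := by rw [abs_mul, abs_mul, abs_mul]
      _ ≤ |X| * ρy + ρx * |Y| + ρx * ρy := by
          gcongr
  have h2 : |z| ≤ |Z| + r := by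
    have := abs_sub_abs_le_abs_sub z Z
    linarith
  have e : x * y * z = X * Y * Z + X * Y * (z - Z) + (x * y - X * Y) * z := by ring
  rw [e]
  have h3 : X * Y * (z - Z) ≤ |X| * |Y| * r :=
    calc X * Y * (z - Z) ≤ |X * Y * (z - Z)| := le_abs_self _
      _ = |X| * |Y| * |z - Z| := by rw [abs_mul, abs_mul]
      _ ≤ |X| * |Y| * r := by gcongr
  have h4 : (x * y - X * Y) * z ≤ (|X| * ρy + ρx * |Y| + ρx * ρy) * (|Z| + r) :=
    calc (x * y - X * Y) * z ≤ |(x * y - X * Y) * z| := le_abs_self _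
      _ = |x * y - X * Y| * |z| := abs_mul _ _
      _ ≤ (|X| * ρy + ρx * |Y| + ρx * ρy) * (|Z| + r) :=
          mul_le_mul h1 h2 (abs_nonneg _) (by positivity)
  linarith

open GramCert ClassWitness in
/-- **PROVED — EXACT CLASS WITNESS.** If the certificate encloses `P`, `z` encloses the constraint vector `d`, and
`classNegOK` passes, then the real vector `v = d_j • w − (d ⬝ᵥ w) • e_j` lies in the class (`d ⬝ᵥ v = 0`, exactly) and
has `vᵀPv < 0`. [folklore] -/
theorem exists_neg_of_classNegOK (c : GramCert) {n : ℕ} (hk : c.k = n) (P : Matrix (Fin n) (Fin n) ℝ)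
    (hP : c.Encloses P) (z : ClassWitness) (d : Fin n → ℝ) (hd : z.EnclosesVec d)
    (h : c.classNegOK z = true) : ∃ v : Fin n → ℝ, d ⬝ᵥ v = 0 ∧ v ⬝ᵥ (P *ᵥ v) < 0 := by
  classical
  simp only [GramCert.classNegOK, Bool.and_eq_true, decide_eq_true_eq] at h
  obtain ⟨hj, hnum⟩ := h
  rw [hk] at hj
  set j : Fin n := ⟨z.j, hj⟩ with hjdef
  set wR : Fin n → ℝ := fun i => (z.wi i : ℝ) with hwR
  set S : ℝ := d ⬝ᵥ wR with hS
  set v : Fin n → ℝ := fun i => d j * wR i - if i = j then S else 0 with hv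
  refine ⟨v, ?_, ?_⟩
  · -- exact orthogonality
    have e1 : d ⬝ᵥ v = ∑ i : Fin n, (d j * (d i * wR i) - if i = j then d i * S else 0) := by
      simp only [dotProduct, hv]
      apply Finset.sum_congr rfl
      intro i _
      split_ifs <;> ring
    rw [e1, Finset.sum_sub_distrib, ← Finset.mul_sum, Finset.sum_ite_eq' Finset.univ j]
    simp only [Finset.mem_univ, if_true]
    simp only [hS, dotProduct]
    ring
  · -- the bound 2^td 2^td 2^t vᵀPv ≤ numBound < 0
    have hT : (0 : ℝ) < 2 ^ c.t := by positivity
    have hD : (0 : ℝ) < 2 ^ z.td := by positivity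
    -- entrywise enclosures, scaled to integers
    have hPs : ∀ i l : Fin n, |2 ^ c.t * P i l - (c.Cij i l : ℝ)| ≤ (c.rij i l : ℝ) := by
      intro i l
      have h0 := hP i l
      have e : 2 ^ c.t * P i l - (c.Cij i l : ℝ) = 2 ^ c.t * (P i l - (c.Cij i l : ℝ) / 2 ^ c.t) := by
        field_simp
      rw [e, abs_mul, abs_of_pos hT]
      calc 2 ^ c.t * |P i l - (c.Cij i l : ℝ) / 2 ^ c.t| ≤ 2 ^ c.t * ((c.rij i l : ℝ) / 2 ^ c.t) := by gcongr
        _ = (c.rij i l : ℝ) := by field_simp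
    have hds : ∀ i : Fin n, |2 ^ z.td * d i - (z.Di i : ℝ)| ≤ (z.rDi i : ℝ) := by
      intro i
      have h0 := hd i
      have e : 2 ^ z.td * d i - (z.Di i : ℝ) = 2 ^ z.td * (d i - (z.Di i : ℝ) / 2 ^ z.td) := by
        field_simp
      rw [e, abs_mul, abs_of_pos hD]
      calc 2 ^ z.td * |d i - (z.Di i : ℝ) / 2 ^ z.td| ≤ 2 ^ z.td * ((z.rDi i : ℝ) / 2 ^ z.td) := by gcongr
        _ = (z.rDi i : ℝ) := by field_simp
    -- the sum S scaled: |2^td S - Sn| ≤ Rs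
    have hSn : ((z.Sn c.k : ℤ) : ℝ) = ∑ i : Fin n, (z.Di i : ℝ) * wR i := by
      simp only [ClassWitness.Sn, hk, Int.cast_sum, Int.cast_mul, hwR]
      rw [Finset.sum_range (fun i => (z.Di i : ℝ) * (z.wi i : ℝ))]
    have hRs : ((z.Rs c.k : ℤ) : ℝ) = ∑ i : Fin n, (z.rDi i : ℝ) * |wR i| := by
      simp only [ClassWitness.Rs, hk, Int.cast_sum, Int.cast_mul, Int.cast_natCast, Int.cast_abs, hwR]
      rw [Finset.sum_range (fun i => (z.rDi i : ℝ) * |(z.wi i : ℝ)|)]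
    have hSb : |2 ^ z.td * S - ((z.Sn c.k : ℤ) : ℝ)| ≤ ((z.Rs c.k : ℤ) : ℝ) := by
      rw [hSn, hRs, hS]
      simp only [dotProduct, Finset.mul_sum, ← Finset.sum_sub_distrib]
      calc |∑ i : Fin n, (2 ^ z.td * (d i * wR i) - (z.Di i : ℝ) * wR i)|
          ≤ ∑ i : Fin n, |2 ^ z.td * (d i * wR i) - (z.Di i : ℝ) * wR i| := Finset.abs_sum_le_sum_abs _ _
        _ ≤ ∑ i : Fin n, (z.rDi i : ℝ) * |wR i| := by
            apply Finset.sum_le_sum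
            intro i _
            have e : 2 ^ z.td * (d i * wR i) - (z.Di i : ℝ) * wR i = (2 ^ z.td * d i - (z.Di i : ℝ)) * wR i := by ring
            rw [e, abs_mul]
            exact mul_le_mul_of_nonneg_right (hds i) (abs_nonneg _)
    -- |2^td v i - V i| ≤ ρ i
    have hVi : ∀ i : Fin n, ((z.Vi c.k i : ℤ) : ℝ) =
        (z.Di z.j : ℝ) * wR i - if i = j then ((z.Sn c.k : ℤ) : ℝ) else 0 := by
      intro i
      have hij : ((i : ℕ) = z.j) ↔ i = j := by
        rw [hjdef, Fin.ext_iff]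
      simp only [ClassWitness.Vi, Int.cast_sub, Int.cast_mul, hwR]
      by_cases h : i = j
      · rw [if_pos (hij.mpr h), if_pos h]
      · rw [if_neg (fun h' => h (hij.mp h')), if_neg h]; simp
    have hrhoi : ∀ i : Fin n, ((z.rhoi c.k i : ℤ) : ℝ) =
        (z.rDi z.j : ℝ) * |wR i| + if i = j then ((z.Rs c.k : ℤ) : ℝ) else 0 := by
      intro i
      have hij : ((i : ℕ) = z.j) ↔ i = j := by
        rw [hjdef, Fin.ext_iff]
      simp only [ClassWitness.rhoi, Int.cast_add, Int.cast_mul, Int.cast_natCast, Int.cast_abs, hwR]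
      by_cases h : i = j
      · rw [if_pos (hij.mpr h), if_pos h]
      · rw [if_neg (fun h' => h (hij.mp h')), if_neg h]; simp
    have hvb : ∀ i : Fin n, |2 ^ z.td * v i - ((z.Vi c.k i : ℤ) : ℝ)| ≤ ((z.rhoi c.k i : ℤ) : ℝ) := by
      intro i
      rw [hVi i, hrhoi i]
      have hdj := hds j
      by_cases h : i = j
      · simp only [hv, if_pos h]
        have e : 2 ^ z.td * (d j * wR i - S) - ((z.Di z.j : ℝ) * wR i - ((z.Sn c.k : ℤ) : ℝ)) =
            (2 ^ z.td * d j - (z.Di z.j : ℝ)) * wR i - (2 ^ z.td * S - ((z.Sn c.k : ℤ) : ℝ)) := by ring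
        rw [e]
        calc |(2 ^ z.td * d j - (z.Di z.j : ℝ)) * wR i - (2 ^ z.td * S - ((z.Sn c.k : ℤ) : ℝ))|
            ≤ |(2 ^ z.td * d j - (z.Di z.j : ℝ)) * wR i| + |2 ^ z.td * S - ((z.Sn c.k : ℤ) : ℝ)| := abs_sub _ _
          _ ≤ (z.rDi z.j : ℝ) * |wR i| + ((z.Rs c.k : ℤ) : ℝ) := by
              rw [abs_mul]
              have hj' : |2 ^ z.td * d j - (z.Di z.j : ℝ)| ≤ (z.rDi z.j : ℝ) := by simpa [hjdef] using hdj
              exact add_le_add (mul_le_mul_of_nonneg_right hj' (abs_nonneg _)) hSb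
      · simp only [hv, if_neg h, sub_zero, add_zero]
        have e : 2 ^ z.td * (d j * wR i) - (z.Di z.j : ℝ) * wR i = (2 ^ z.td * d j - (z.Di z.j : ℝ)) * wR i := by ring
        rw [e, abs_mul]
        have hj' : |2 ^ z.td * d j - (z.Di z.j : ℝ)| ≤ (z.rDi z.j : ℝ) := by simpa [hjdef] using hdj
        exact mul_le_mul_of_nonneg_right hj' (abs_nonneg _)
    -- termwise bound and summation
    have hterm : ∀ i l : Fin n, (2 ^ z.td * v i) * (2 ^ z.td * v l) * (2 ^ c.t * P i l) ≤ (c.numTerm z i l : ℝ) := by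
      intro i l
      have h0 := mul3_le (hvb i) (hvb l) (hPs i l)
      simp only [GramCert.numTerm, Int.cast_add, Int.cast_mul, Int.cast_abs, Int.cast_natCast]
      exact h0
    have hform : (2 ^ z.td * 2 ^ z.td * 2 ^ c.t) * (v ⬝ᵥ (P *ᵥ v)) =
        ∑ i : Fin n, ∑ l : Fin n, (2 ^ z.td * v i) * (2 ^ z.td * v l) * (2 ^ c.t * P i l) := by
      simp only [dotProduct, Matrix.mulVec, Finset.mul_sum]
      apply Finset.sum_congr rfl; intro i _
      apply Finset.sum_congr rfl; intro l _
      ring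
    have hNB : (c.numBound z : ℝ) = ∑ i : Fin n, ∑ l : Fin n, (c.numTerm z i l : ℝ) := by
      simp only [GramCert.numBound, GramCert.numRow, Int.cast_sum, hk]
      rw [Finset.sum_range (fun i => ∑ l ∈ Finset.range n, (c.numTerm z i l : ℝ))]
      apply Finset.sum_congr rfl; intro i _
      rw [Finset.sum_range]
    have hle : (2 ^ z.td * 2 ^ z.td * 2 ^ c.t) * (v ⬝ᵥ (P *ᵥ v)) ≤ (c.numBound z : ℝ) := by
      rw [hform, hNB]
      exact Finset.sum_le_sum fun i _ => Finset.sum_le_sum fun l _ => hterm i l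
    have hneg : (c.numBound z : ℝ) < 0 := by exact_mod_cast hnum
    have hpos : (0 : ℝ) < 2 ^ z.td * 2 ^ z.td * 2 ^ c.t := by positivity
    by_contra hcon
    have hcon' : 0 ≤ v ⬝ᵥ (P *ᵥ v) := le_of_not_gt hcon
    have : 0 ≤ (2 ^ z.td * 2 ^ z.td * 2 ^ c.t) * (v ⬝ᵥ (P *ᵥ v)) := mul_nonneg hpos.le hcon'
    linarith

open GramCert ClassWitness in
/-- **PROVED — NEGATIVE CONDITIONED CELL (abstract form).** If the certificate encloses the PENALISED matrix
`A + s • d dᵀ`, `z` encloses `d` and `classNegOK` passes, then some `v` in the class has `vᵀAv < 0` (so the bottom of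
the form on the class inside `V_N` is negative). [folklore] -/
theorem exists_classNeg (c : GramCert) {n : ℕ} (hk : c.k = n) (A : Matrix (Fin n) (Fin n) ℝ) (s : ℝ)
    (d : Fin n → ℝ) (hP : c.Encloses (A + s • Matrix.vecMulVec d d)) (z : ClassWitness) (hd : z.EnclosesVec d)
    (h : c.classNegOK z = true) : ∃ v : Fin n → ℝ, d ⬝ᵥ v = 0 ∧ v ≠ 0 ∧ v ⬝ᵥ (A *ᵥ v) < 0 := by
  obtain ⟨v, hdv, hneg⟩ := exists_neg_of_classNegOK c hk _ hP z d hd h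
  rw [form_add_smul_vecMulVec A s d v hdv] at hneg
  refine ⟨v, hdv, ?_, hneg⟩
  rintro rfl
  simp at hneg


end Summit.RiemannHypothesis.RiemannHypothesis.Theorems.MotivicDoor.CertPos
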